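import Summits.QuantumFields.YangMills.Theorems.AlphaInputsT3ACv3ChargedGlueXs
import Summits.QuantumFields.YangMills.Theorems.AlphaInputsT3ACv3RecordFL
import Summits.QuantumFields.YangMills.Theorems.AlphaInputsT3ACv3HLiftBigClause
import Summits.QuantumFields.YangMills.Theorems.AlphaInputsT3ACv3ZfullFloor
import Summits.QuantumFields.YangMills.Theorems.AlphaInputsT3ACv3DataSchemaLC
import HarnessLib

/-!
# `AlphaInputsT3ACv3XsSelectionOfSizes` — THE Sel∕Xs SELECTION ROW AT THE RECORD SIZES: `∃ UkH, InClassSelT3Xs …` from the record's size rows, ONE `B₃`-floor, and the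
# located kinematic row (U2) — every other input ((EL) inner exact lifts, the collar (N2′), `4π ≤ C68`) discharged BY NAME from the tree — cell `ym3-torus`,
# crux stmt-QuantumFields-19936 (`HistoryTailL`, line v5p10), width seat ym-ust-19936-w5 (g4); offer (o2) of 10:13Z

WHY.  ✓ `exists_inClassSelT3Xs_of_innerLift_of_collar_of_profRec` (this seat, `…v3ChargedGlueXs`) gives the Sel∕Xs display's selection conjunct `∃ UkH, InClassSelT3Xs F 𝔠 γ hγ hγ1 K Ut UkH`
from (EL) `InnerExactLiftT3`, (N2′) `CollarE … K`, `4π ≤ C68` and (U2).  All but (U2) are theorems of the tree at the record's sizes: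
* (EL) ⇐ ✓ `innerExactLiftT3_of_fineLifts_of_sizes` (★alpha-2, `…v3RecordFL`: the window∕budget provisos from `hA3`, `hA2`, `hC`, `hCe`, `hCa`) ⇐ `InnerFineLiftsT3 … 𝔠.B₃` ⇐
  ✓ `HLiftWindowKnit.innerFineLiftsT3_of_clauses_floor` (★w6, `…v3ZfullFloor`: ONE floor `max (max (B_big+1) 257·L²) (avgWindowFactor L ∕ (24·ε_FL)) ≤ B₃`) with its big-`k` clause
  `hBig` DISCHARGED by ✓ `HLiftWindowKnit.hBig_of_hLift_clause` (★w4 g3's M22 `hLift_clause`, final form, `B_big := 10²⁷`, `ε_FL := 1∕(10³⁴·L)`);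
* (N2′) ⇐ ✓ `collarE_T3_of_M₁_ge (7L + 3 ≤ M₁)`; `4π ≤ C68` ⇐ ✓ `four_pi_le_C68_of_sizes (1 ≤ 2B₃) (4B₃L²·awf ≤ C68)` (★alpha-2, `…v3DataSchemaLC`).
THIS FILE (def-free):
* §1 ★★ `innerExactLiftT3_of_sizes` — (EL) with NO displayed row: the five size rows of `PinnedPartsT3ACRecSelXsV4Chi` + the `B₃`-floor `max (max (10²⁷+1) 257·L²) (avgWindowFactor L ∕
  (24·(1∕(10³⁴·L)))) ≤ B₃`;
* §2 ★★★ `exists_inClassSelT3Xs_of_sizes_of_profRec` — for a measurable trivial-history family `Ut`: size rows + collar + floor + (U2) ⟹ `∃ UkH, InClassSelT3Xs F 𝔠 γ hγ hγ1 K Ut UkH ∧`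
  (argmin of the Wilson action over `𝒞_Xs(k, h, W)` at every admissible non-trivial `(k, h, W)`);
* §3 ★★★ `exists_inClassSelT3Xs_of_trivMinimiserRows_of_sizes_of_profRec` — the same from (D5) `TrivMinimiserRowsT3 … a₀ a₁ K Ut` (which carries `Ut`'s measurability and
  `Ut 0 = id`), concluded in the binder shape of `DataRowsT3XsChiSel`: `∃ UkH, (∀ V, UkH 0 triv V = V) ∧ InClassSelT3Xs … ∧ argmin`.  So, per family and `(γ, K)`, the Sel∕Xs
  display's (O‴χₛ) clause reads «(U2) ∧ ∃ 𝔖 𝔄, NODE O's data rows FOR THIS argmin» — the selection half is a theorem.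
HONEST FRAMING.  Assembly of landed theorems; (U2) «the enlarged-region profile is (67)-large in RECORDING currency at every admissible history» (★w4-19936 g4∕g5's located row,
the `blockAvg ℰp` abelian twin of ✓ `avgIter_abelCfg`) stays DISPLAYED; the argmin is NOT claimed to be print's (42)-minimiser; NODE O's data rows, the stub 2′χ, the crux
`HistoryTailL`, T8 and any gap are NOT claimed.  Count-neutral helper (`--supports stmt-QuantumFields-19936`); registry untouched.  YM₃ on the three-torus is rung R3 of the
programme, NOT the Clay problem (no bearing on d = 4, infinite volume, or a mass gap).

References: T. Bałaban, Commun. Math. Phys. 102 (1985) 277–309 [Balaban1985Variational] (Thm 1 (8) p.279, (11)–(15) pp.279–280); Commun. Math. Phys. 102 (1985) 255–275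
[Balaban1985UV3] ((7) p.257, (40)–(42) p.266, (45) p.267, (67)–(68) p.273); Commun. Math. Phys. 98 (1985) 17–51 [Balaban1985Averaging] (Props. 4–5 pp.38–42).
-/

set_option autoImplicit false

noncomputable section

namespace Summit.QuantumFields.YangMills.Theorems

open MeasureTheory Set
open scoped Matrix Matrix.Norms.L2Operator
open Literature.MathematicalPhysics.QuantumFieldTheory.Balaban1983to89
open Literature.MathematicalPhysics.QuantumFieldTheory.Balaban1983to89.T3ContinuumYM3Torus
open Literature.MathematicalPhysics.QuantumFieldTheory.Balaban1983to89.T3UnitLawDensityEML (ℰp)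
open Literature.MathematicalPhysics.QuantumFieldTheory.Balaban1983to89.T3UnitScaleTilt (θBal)
open Literature.MathematicalPhysics.QuantumFieldTheory.Balaban1983to89.ExpMeanLog (deltaSU)
open Literature.MathematicalPhysics.QuantumFieldTheory.Balaban1985CMP102.Setting
open Summit.QuantumFields.Balaban3D.Carriers
open Summit.QuantumFields.Balaban3D.Proofs.Primitives
open Summit.QuantumFields.Balaban3D.Proofs.Thresholds (Q0 Q0_pos)
open Summit.QuantumFields.YangMills.Theorems.ProfileEnlarged (CollarE profE)
open Summit.QuantumFields.YangMills.Theorems.HLiftWindowKnit (hBig_of_hLift_clause innerFineLiftsT3_of_clauses_floor)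

section T3

variable {F : T3Family} {𝔠 : AlphaConsts F.L (suGroupModel 2).N}

/-! ## §1 (EL) at the record sizes, no displayed row -/

/-- ★★ **(EL) INNER EXACT REGULAR LIFTS AT THE RECORD SIZES — NO DISPLAYED ROW**: the size rows `hA3`, `hA2`, `hC`, `hCe`, `hCa` of the record (`a₁ > 0`) and the ONE
`B₃`-floor `max (max (10²⁷+1) 257·L²) (avgWindowFactor L ∕ (24·(1∕(10³⁴·L)))) ≤ B₃` give `InnerExactLiftT3 F 𝔠 γ hγ hγ1 K` for every coupling of the window and every run:
✓ `innerExactLiftT3_of_fineLifts_of_sizes` ∘ ✓ `innerFineLiftsT3_of_clauses_floor` ∘ ✓ `hBig_of_hLift_clause` (M22's `hLift_clause`).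
[cite: Balaban1985Variational, Thm 1 (8) p.279, (11)–(15) pp.279–280; Balaban1985UV3, (40)+(42) p.266, (45) p.267, (68) p.273] -/
theorem AlphaInputsT3AC.innerExactLiftT3_of_sizes {a₁ : ℝ} (ha₁ : 0 < a₁)
    (hA3 : (143 * ((((3 + 4 : ℕ) : ℝ)) ^ 2 / 4) ^ 2) * (2 * (𝔠.B₃ * a₁)) ≤ 1 / 3)
    (hA2 : 2 * (2 * (𝔠.B₃ * a₁)) ≤ 2 * deltaSU (Fin 2) / (((3 + 4) * F.L : ℕ) : ℝ) ^ 2)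
    (hC : 4 * 𝔠.B₃ * (F.L : ℝ) ^ 2 * avgWindowFactor F.L ≤ 𝔠.C68)
    (hCe : Real.exp (𝔠.p₀ - 1) ≤ 3 * B7Prop2Explicit.C0 3 * 𝔠.C68 * (𝔠.b₀ * Q0 𝔠.p₀))
    (hCa : (𝔠.b₀ * Q0 𝔠.p₀) * (2 * (F.L : ℝ) ^ 2 * avgWindowFactor F.L) ^ 2 ≤ 3 * B7Prop2Explicit.C0 3 * 𝔠.C68 * a₁ ^ 2)
    (hBfl : max (max ((10 : ℝ) ^ 27 + 1) 257 * (F.L : ℝ) ^ 2) (avgWindowFactor F.L / (24 * (1 / (10 ^ 34 * (F.L : ℝ))))) ≤ 𝔠.B₃)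
    {γ : ℝ} (hγ : 0 < γ) (hγ1 : γ ≤ (min 𝔠.gamma0 1) ^ 2) (K : ℕ) :
    AlphaInputsT3AC.InnerExactLiftT3 F 𝔠 γ hγ hγ1 K := by
  have hL0 : (0 : ℝ) < (F.L : ℝ) := by exact_mod_cast (zero_lt_one.trans F.hL.2)
  have hε : (0 : ℝ) < 1 / (10 ^ 34 * (F.L : ℝ)) := by positivity
  exact AlphaInputsT3AC.innerExactLiftT3_of_fineLifts_of_sizes ha₁ hA3 hA2 hC hCe hCa hγ hγ1 K
    (innerFineLiftsT3_of_clauses_floor F 𝔠 γ hγ hγ1 K hε hBfl (hBig_of_hLift_clause F 𝔠 γ hγ hγ1 K))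

/-! ## §2 The selection row at the record sizes modulo (U2) -/

/-- ★★★ **THE Sel∕Xs SELECTION ROW AT THE RECORD SIZES MODULO (U2)**: for a MEASURABLE trivial-history family `Ut`, the record's size rows, the collar `7L + 3 ≤ M₁`, the
`B₃`-floor of §1, and (U2) «`profE` is (67)-large in recording currency at every admissible history» give `∃ UkH, InClassSelT3Xs F 𝔠 γ hγ hγ1 K Ut UkH` with `UkH k h W` an argmin
of the Wilson action over `𝒞_Xs(k, h, W)` at every admissible non-trivial `(k, h, W)` — ✓ `exists_inClassSelT3Xs_of_innerLift_of_collar_of_profRec` with (EL) by §1, (N2′) by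
✓ `collarE_T3_of_M₁_ge`, `4π ≤ C68` by ✓ `four_pi_le_C68_of_sizes`. [cite: Balaban1985UV3, (40)–(42) p.266 + (67)–(68) p.273; Balaban1985Variational, Thm 1 (8) p.279, (11)–(13) pp.279–280] -/
theorem AlphaInputsT3AC.exists_inClassSelT3Xs_of_sizes_of_profRec {a₁ : ℝ} (ha₁ : 0 < a₁)
    (hA3 : (143 * ((((3 + 4 : ℕ) : ℝ)) ^ 2 / 4) ^ 2) * (2 * (𝔠.B₃ * a₁)) ≤ 1 / 3)
    (hA2 : 2 * (2 * (𝔠.B₃ * a₁)) ≤ 2 * deltaSU (Fin 2) / (((3 + 4) * F.L : ℕ) : ℝ) ^ 2)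
    (hB₃ : 1 ≤ 2 * 𝔠.B₃) (hC : 4 * 𝔠.B₃ * (F.L : ℝ) ^ 2 * avgWindowFactor F.L ≤ 𝔠.C68)
    (hCe : Real.exp (𝔠.p₀ - 1) ≤ 3 * B7Prop2Explicit.C0 3 * 𝔠.C68 * (𝔠.b₀ * Q0 𝔠.p₀))
    (hCa : (𝔠.b₀ * Q0 𝔠.p₀) * (2 * (F.L : ℝ) ^ 2 * avgWindowFactor F.L) ^ 2 ≤ 3 * B7Prop2Explicit.C0 3 * 𝔠.C68 * a₁ ^ 2)
    (hM : 7 * F.L + 3 ≤ 𝔠.M₁)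
    (hBfl : max (max ((10 : ℝ) ^ 27 + 1) 257 * (F.L : ℝ) ^ 2) (avgWindowFactor F.L / (24 * (1 / (10 ^ 34 * (F.L : ℝ))))) ≤ 𝔠.B₃)
    {γ : ℝ} (hγ : 0 < γ) (hγ1 : γ ≤ (min 𝔠.gamma0 1) ^ 2) (K : ℕ)
    (Ut : (k : ℕ) → GaugeField (F.P K) k (Matrix.specialUnitaryGroup (Fin 2) ℂ) → GaugeField (F.P K) 0 (Matrix.specialUnitaryGroup (Fin 2) ℂ))
    (hUt : ∀ k, Measurable (Ut k))
    (hU2 : ∀ (k : ℕ), k ≤ K → ∀ (h : Hist (F.P K) k),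
      Hist.Admissible 𝔠.lane.carrier.M₁ (rcolOf (T3Scales F γ hγ (hγ1.trans (sq_min_one_le _ 𝔠.gamma0_pos)) K) 𝔠.lane.carrier) k h →
      ∀ (X : Matrix (Fin 2) (Fin 2) ℂ) (hX : X ∈ (suGroupModel 2).lie), X ≠ 0 →
        profE (T3Scales F γ hγ (hγ1.trans (sq_min_one_le _ 𝔠.gamma0_pos)) K) 𝔠 h hX ∈ AlphaInputsT3AC.large67RecSet F 𝔠 γ hγ hγ1 K k h) :
    ∃ UkH : (k : ℕ) → Hist (F.P K) k → GaugeField (F.P K) k (Matrix.specialUnitaryGroup (Fin 2) ℂ) →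
        GaugeField (F.P K) 0 (Matrix.specialUnitaryGroup (Fin 2) ℂ),
      AlphaInputsT3AC.InClassSelT3Xs F 𝔠 γ hγ hγ1 K Ut UkH ∧
      ∀ (k : ℕ), k ≤ K → ∀ (h : Hist (F.P K) k),
        Hist.Admissible 𝔠.lane.carrier.M₁ (rcolOf (T3Scales F γ hγ (hγ1.trans (sq_min_one_le _ 𝔠.gamma0_pos)) K) 𝔠.lane.carrier) k h →
        h ≠ Hist.triv (F.P K) k → ∀ (W : GaugeField (F.P K) k (Matrix.specialUnitaryGroup (Fin 2) ℂ)),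
          UkH k h W ∈ AlphaInputsT3AC.adaptedClassT3Xs F 𝔠 γ hγ hγ1 K k h W ∧
          IsMinOn (fun U : GaugeField (F.P K) 0 (Matrix.specialUnitaryGroup (Fin 2) ℂ) => wilsonAction4 U)
            (AlphaInputsT3AC.adaptedClassT3Xs F 𝔠 γ hγ hγ1 K k h W) (UkH k h W) :=
  AlphaInputsT3AC.exists_inClassSelT3Xs_of_innerLift_of_collar_of_profRec (𝔠 := 𝔠) (hγ := hγ) (hγ1 := hγ1) Ut hUt
    (AlphaInputsT3AC.innerExactLiftT3_of_sizes ha₁ hA3 hA2 hC hCe hCa hBfl hγ hγ1 K)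
    (AlphaInputsT3AC.collarE_T3_of_M₁_ge (hγ := hγ) (hγ1 := hγ1) hM) (AlphaInputsT3AC.four_pi_le_C68_of_sizes (F := F) hB₃ hC) hU2

/-! ## §3 The same from (D5), in the binder shape of `DataRowsT3XsChiSel` -/

/-- ★★★ **THE SELECTION HALF OF (O‴χₛ) IS A THEOREM AT THE RECORD SIZES, MODULO (U2)**: from (D5) `TrivMinimiserRowsT3 F 𝔠 γ hγ hγ1 a₀ a₁ K Ut` (its `Ut 0 = id` and
measurability clauses), the size rows, the collar, the `B₃`-floor and (U2): `∃ UkH, (∀ V, UkH 0 (Hist.triv _ 0) V = V) ∧ InClassSelT3Xs F 𝔠 γ hγ hγ1 K Ut UkH ∧` argmin — the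
first two binders of `DataRowsT3XsChiSel K Ut` for THIS map, leaving «∃ 𝔖 𝔄, NODE O's data rows for it» as the display's only other content.
[cite: Balaban1985UV3, Thm 2 p.272 + (40)–(42) p.266 + (67)–(68) p.273; Balaban1985Variational, Thm 1 (8) p.279] -/
theorem AlphaInputsT3AC.exists_inClassSelT3Xs_of_trivMinimiserRows_of_sizes_of_profRec {a₀ a₁ : ℝ} (ha₁ : 0 < a₁)
    (hA3 : (143 * ((((3 + 4 : ℕ) : ℝ)) ^ 2 / 4) ^ 2) * (2 * (𝔠.B₃ * a₁)) ≤ 1 / 3)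
    (hA2 : 2 * (2 * (𝔠.B₃ * a₁)) ≤ 2 * deltaSU (Fin 2) / (((3 + 4) * F.L : ℕ) : ℝ) ^ 2)
    (hB₃ : 1 ≤ 2 * 𝔠.B₃) (hC : 4 * 𝔠.B₃ * (F.L : ℝ) ^ 2 * avgWindowFactor F.L ≤ 𝔠.C68)
    (hCe : Real.exp (𝔠.p₀ - 1) ≤ 3 * B7Prop2Explicit.C0 3 * 𝔠.C68 * (𝔠.b₀ * Q0 𝔠.p₀))
    (hCa : (𝔠.b₀ * Q0 𝔠.p₀) * (2 * (F.L : ℝ) ^ 2 * avgWindowFactor F.L) ^ 2 ≤ 3 * B7Prop2Explicit.C0 3 * 𝔠.C68 * a₁ ^ 2)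
    (hM : 7 * F.L + 3 ≤ 𝔠.M₁)
    (hBfl : max (max ((10 : ℝ) ^ 27 + 1) 257 * (F.L : ℝ) ^ 2) (avgWindowFactor F.L / (24 * (1 / (10 ^ 34 * (F.L : ℝ))))) ≤ 𝔠.B₃)
    {γ : ℝ} (hγ : 0 < γ) (hγ1 : γ ≤ (min 𝔠.gamma0 1) ^ 2) (K : ℕ)
    {Ut : (k : ℕ) → GaugeField (F.P K) k (Matrix.specialUnitaryGroup (Fin 2) ℂ) → GaugeField (F.P K) 0 (Matrix.specialUnitaryGroup (Fin 2) ℂ)}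
    (hT : AlphaInputsT3AC.TrivMinimiserRowsT3 F 𝔠 γ hγ hγ1 a₀ a₁ K Ut)
    (hU2 : ∀ (k : ℕ), k ≤ K → ∀ (h : Hist (F.P K) k),
      Hist.Admissible 𝔠.lane.carrier.M₁ (rcolOf (T3Scales F γ hγ (hγ1.trans (sq_min_one_le _ 𝔠.gamma0_pos)) K) 𝔠.lane.carrier) k h →
      ∀ (X : Matrix (Fin 2) (Fin 2) ℂ) (hX : X ∈ (suGroupModel 2).lie), X ≠ 0 →
        profE (T3Scales F γ hγ (hγ1.trans (sq_min_one_le _ 𝔠.gamma0_pos)) K) 𝔠 h hX ∈ AlphaInputsT3AC.large67RecSet F 𝔠 γ hγ hγ1 K k h) :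
    ∃ (UkH : (k : ℕ) → Hist (F.P K) k → GaugeField (F.P K) k (Matrix.specialUnitaryGroup (Fin 2) ℂ) →
        GaugeField (F.P K) 0 (Matrix.specialUnitaryGroup (Fin 2) ℂ))
      (_ : ∀ V : GaugeField (F.P K) 0 (Matrix.specialUnitaryGroup (Fin 2) ℂ), UkH 0 (Hist.triv (F.P K) 0) V = V),
      AlphaInputsT3AC.InClassSelT3Xs F 𝔠 γ hγ hγ1 K Ut UkH ∧
      ∀ (k : ℕ), k ≤ K → ∀ (h : Hist (F.P K) k),
        Hist.Admissible 𝔠.lane.carrier.M₁ (rcolOf (T3Scales F γ hγ (hγ1.trans (sq_min_one_le _ 𝔠.gamma0_pos)) K) 𝔠.lane.carrier) k h →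
        h ≠ Hist.triv (F.P K) k → ∀ (W : GaugeField (F.P K) k (Matrix.specialUnitaryGroup (Fin 2) ℂ)),
          UkH k h W ∈ AlphaInputsT3AC.adaptedClassT3Xs F 𝔠 γ hγ hγ1 K k h W ∧
          IsMinOn (fun U : GaugeField (F.P K) 0 (Matrix.specialUnitaryGroup (Fin 2) ℂ) => wilsonAction4 U)
            (AlphaInputsT3AC.adaptedClassT3Xs F 𝔠 γ hγ hγ1 K k h W) (UkH k h W) := by
  obtain ⟨UkH, hsel, harg⟩ := AlphaInputsT3AC.exists_inClassSelT3Xs_of_sizes_of_profRec (𝔠 := 𝔠) ha₁ hA3 hA2 hB₃ hC hCe hCa hM hBfl hγ hγ1 K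
    Ut hT.2.1 hU2
  refine ⟨UkH, fun V => ?_, hsel, harg⟩
  rw [hsel.1 0]
  exact hT.1 V

end T3

end Summit.QuantumFields.YangMills.Theorems

end
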